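import Summits.KontsevichZagierPeriods.KontsevichZagierPeriods.Theorems.SoloBlindTerms
import Literature.NumberTheory.Transcendental.KZDilationRationalNormalForm
import Literature.NumberTheory.Transcendental.KZGroundingRelations
import Mathlib.Topology.Algebra.Polynomial
import HarnessLib

/-!
# The Kontsevich–Zagier conjecture in dimension `≤ 1`, VI: rational pieces are cell sums

For `P, Q ∈ ℚ[X]` with `Q ≠ 0` on an open interval `(a, b) ∋ 0` with algebraic end-points, and a
compact sub-interval `[u, v] ⊂ (a, b)` with algebraic end-points, the piece
`[[u, v], P(x)/Q(x) dx]` is a cell sum.  Proof: the real-algebraic partial-fraction normal form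
`P/Q = ρ' + Σ_k T_k` (`KZ.BakerSectorComplex.exists_bakerNormalForm`, with `ρ` semialgebraic and
analytic and `T_k(x) = (γ_k(−p_k + (p_k² + q_k²) x) + δ_k q_k)/((1 − p_k x)² + (q_k x)²)`) splits
the piece, by additivity of the integrand, into a Newton–Leibniz piece `≡ K(ρ(v) − ρ(u))` and
the terms `T_k`, each of which is (after completing the square) one of the three primitive terms
of part V.
-/

noncomputable section

open MeasureTheory Set Filter Finset
open scoped BigOperators Topology Polynomial

namespace Summit.KontsevichZagierPeriods.KontsevichZagierPeriods.Theorems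

open Literature.NumberTheory.Transcendental
open Literature.NumberTheory.Transcendental.KZ
open Literature.ModelTheory.ExponentialFields (IsSemialgebraic)

namespace SoloBlind

/-! ## One term of the normal form -/

/-- The `k`-th term of the real partial-fraction normal form. -/
def bakerTerm (p q γ δ : ℝ) (x : ℝ) : ℝ :=
  (γ * (-p + (p ^ 2 + q ^ 2) * x) + δ * q) / ((1 - p * x) ^ 2 + (q * x) ^ 2)

/-- Unfolding lemma for `bakerTerm`. -/
theorem bakerTerm_apply (p q γ δ x : ℝ) : bakerTerm p q γ δ x =
    (γ * (-p + (p ^ 2 + q ^ 2) * x) + δ * q) / ((1 - p * x) ^ 2 + (q * x) ^ 2) := rfl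

/-- The denominator of a term is positive under the normal-form side condition. -/
theorem bakerTerm_den_pos {p q x : ℝ} (h : 0 < 1 - p * x ∨ q * x ≠ 0) :
    0 < (1 - p * x) ^ 2 + (q * x) ^ 2 := by
  rcases h with h | h
  · have := pow_pos h 2; positivity
  · have := sq_pos_of_ne_zero h; positivity

/-- Completing the square in the denominator of a term (`q ≠ 0`). -/
theorem bakerTerm_den_eq (p q x : ℝ) (hq : q ≠ 0) :
    (1 - p * x) ^ 2 + (q * x) ^ 2 =
      (p ^ 2 + q ^ 2) * ((x - p / (p ^ 2 + q ^ 2)) ^ 2 + (|q| / (p ^ 2 + q ^ 2)) ^ 2) := by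
  have hm : p ^ 2 + q ^ 2 ≠ 0 := by have := sq_pos_of_ne_zero hq; positivity
  rw [div_pow (|q|), sq_abs]
  field_simp
  ring

/-- A term with `q ≠ 0` is a linear-over-quadratic plus an inverse-quadratic term. -/
theorem bakerTerm_eq_of_ne (p q γ δ x : ℝ) (hq : q ≠ 0) :
    bakerTerm p q γ δ x =
      γ * (x - p / (p ^ 2 + q ^ 2)) /
          ((x - p / (p ^ 2 + q ^ 2)) ^ 2 + (|q| / (p ^ 2 + q ^ 2)) ^ 2) +
        δ * q / (p ^ 2 + q ^ 2) /
          ((x - p / (p ^ 2 + q ^ 2)) ^ 2 + (|q| / (p ^ 2 + q ^ 2)) ^ 2) := by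
  have hm : p ^ 2 + q ^ 2 ≠ 0 := by have := sq_pos_of_ne_zero hq; positivity
  have hE : (x - p / (p ^ 2 + q ^ 2)) ^ 2 + (|q| / (p ^ 2 + q ^ 2)) ^ 2 ≠ 0 := by
    have : 0 < |q| / (p ^ 2 + q ^ 2) := by positivity
    positivity
  rw [bakerTerm, bakerTerm_den_eq p q x hq, ← add_div, mul_comm (p ^ 2 + q ^ 2), ← div_div]
  congr 1
  field_simp
  ring

/-- A term with `q = 0` is an inverse-linear term. -/
theorem bakerTerm_eq_of_eq_zero (p γ δ x : ℝ) (h : 1 - p * x ≠ 0) :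
    bakerTerm p 0 γ δ x = -(γ * p) / (1 - p * x) := by
  rw [bakerTerm]
  field_simp
  ring

/-- A term is continuous where the side condition holds. -/
theorem continuousOn_bakerTerm {p q γ δ : ℝ} {S : Set ℝ}
    (h : ∀ x ∈ S, 0 < 1 - p * x ∨ q * x ≠ 0) : ContinuousOn (bakerTerm p q γ δ) S := by
  refine ContinuousOn.div (by fun_prop) (by fun_prop) fun x hx => (bakerTerm_den_pos (h x hx)).ne'

/-- A term with algebraic parameters is `ℚ`-semialgebraic on a semialgebraic line set where the
side condition holds. -/
theorem isSemialgebraicFunOn_bakerTerm {p q γ δ : ℝ} (hp : IsAlgebraic ℚ p)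
    (hq : IsAlgebraic ℚ q) (hγ : IsAlgebraic ℚ γ) (hδ : IsAlgebraic ℚ δ) {S : Set ℝ}
    (hS : IsSemialgebraic ℚ (line S)) (h : ∀ x ∈ S, 0 < 1 - p * x ∨ q * x ≠ 0) :
    IsSemialgebraicFunOn ℚ (line S) (fun x => bakerTerm p q γ δ (x 0)) := by
  have hc : ∀ {c : ℝ}, IsAlgebraic ℚ c → IsSemialgebraicFunOn ℚ (line S) (fun _ => c) :=
    fun hc => isSemialgebraicFunOn_const_of_isAlgebraic hS hc
  have hx : IsSemialgebraicFunOn ℚ (line S) (fun x => x 0) := isSemialgebraicFunOn_apply hS 0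
  have hnum : IsSemialgebraicFunOn ℚ (line S)
      (fun x => γ * (-p + (p ^ 2 + q ^ 2) * x 0) + δ * q) :=
    ((hc hγ).fun_mul ((hc hp.neg).fun_add
      ((hc ((by simpa [sq] using hp.mul hp : IsAlgebraic ℚ (p ^ 2)).add
        (by simpa [sq] using hq.mul hq : IsAlgebraic ℚ (q ^ 2)))).fun_mul hx))).fun_add
      (hc (hδ.mul hq))
  have hden : IsSemialgebraicFunOn ℚ (line S) (fun x => (1 - p * x 0) ^ 2 + (q * x 0) ^ 2) :=
    (((hc isAlgebraic_one).fun_sub ((hc hp).fun_mul hx)).fun_pow 2).fun_add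
      (((hc hq).fun_mul hx).fun_pow 2)
  exact hnum.div hden fun x hx => (bakerTerm_den_pos (h (x 0) hx)).ne'

section term

variable {u v : ℝ}

/-- **One term of the normal form, integrated over `[u, v]`, is a cell sum.** -/
theorem isCellSum_lineRep_bakerTerm (hu : IsAlgebraic ℚ u) (hv : IsAlgebraic ℚ v) (huv : u ≤ v)
    {p q γ δ : ℝ} (hp : IsAlgebraic ℚ p) (hq : IsAlgebraic ℚ q) (hγ : IsAlgebraic ℚ γ)
    (hδ : IsAlgebraic ℚ δ) (hpos : ∀ x ∈ Icc u v, 0 < 1 - p * x ∨ q * x ≠ 0)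
    {hS : IsSemialgebraic ℚ (line (Icc u v))}
    {hf : IsSemialgebraicFunOn ℚ (line (Icc u v)) (fun x => bakerTerm p q γ δ (x 0))}
    {hi : IntegrableOn (bakerTerm p q γ δ) (Icc u v)} :
    IsCellSum (of (lineRep (Icc u v) (bakerTerm p q γ δ) hS hf hi)) := by
  have hc : ∀ {c : ℝ}, IsAlgebraic ℚ c → IsSemialgebraicFunOn ℚ (line (Icc u v)) (fun _ => c) :=
    fun hc => isSemialgebraicFunOn_const_of_isAlgebraic hS hc
  have hx : IsSemialgebraicFunOn ℚ (line (Icc u v)) (fun x => x 0) :=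
    isSemialgebraicFunOn_apply hS 0
  by_cases hq0 : q = 0
  · subst hq0
    have hpos' : ∀ x ∈ Icc u v, 0 < 1 - p * x := fun x hx => by
      rcases hpos x hx with h | h
      · exact h
      · simp at h
    by_cases hp0 : p = 0
    · subst hp0
      refine isCellSum_of_mem_relations (of_mem_relations_of_eqOn_zero _ fun x _ => ?_)
      simp [lineRep_integrand, bakerTerm]
    · -- `T(x) = (−γ p)/(1 − p x)`
      have he : IsAlgebraic ℚ (-(γ * p)) := (hγ.mul hp).neg
      have hf' : IsSemialgebraicFunOn ℚ (line (Icc u v)) (fun x => -(γ * p) / (1 - p * x 0)) :=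
        (hc he).div ((hc isAlgebraic_one).fun_sub ((hc hp).fun_mul hx))
          fun x hx => (hpos' (x 0) hx).ne'
      have hi' : IntegrableOn (fun x => -(γ * p) / (1 - p * x)) (Icc u v) :=
        (ContinuousOn.div (by fun_prop) (by fun_prop) fun x hx => (hpos' x hx).ne').integrableOn_compact
          isCompact_Icc
      refine (isCellSum_lineRep_inv_linear hu hv huv he hp hp0 hpos' (hS := hS) (hf := hf')
        (hi := hi')).of_sub_mem
        (of_sub_of_mem_relations_of_eqOn (by simp only [lineRep_domain]) fun x hx => ?_)
      simp only [lineRep_integrand]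
      exact bakerTerm_eq_of_eq_zero p γ δ (x 0) (hpos' (x 0) hx).ne'
  · -- complete the square: `m = p² + q²`, `x₀ = p/m`, `B = |q|/m`
    obtain ⟨m, hm⟩ : ∃ m : ℝ, m = p ^ 2 + q ^ 2 := ⟨_, rfl⟩
    obtain ⟨x₀, hx₀⟩ : ∃ x₀ : ℝ, x₀ = p / m := ⟨_, rfl⟩
    obtain ⟨B, hB⟩ : ∃ B : ℝ, B = |q| / m := ⟨_, rfl⟩
    have hm0 : 0 < m := by rw [hm]; have := sq_pos_of_ne_zero hq0; positivity
    have hma : IsAlgebraic ℚ m := by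
      rw [hm]
      exact (by simpa [sq] using hp.mul hp : IsAlgebraic ℚ (p ^ 2)).add
        (by simpa [sq] using hq.mul hq : IsAlgebraic ℚ (q ^ 2))
    have habsq : IsAlgebraic ℚ |q| := by
      rcases abs_choice q with h | h <;> rw [h]
      exacts [hq, hq.neg]
    have hx₀a : IsAlgebraic ℚ x₀ := by rw [hx₀, div_eq_mul_inv]; exact hp.mul hma.inv
    have hBa : IsAlgebraic ℚ B := by rw [hB, div_eq_mul_inv]; exact habsq.mul hma.inv
    have hB0 : 0 < B := by rw [hB]; exact div_pos (abs_pos.mpr hq0) hm0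
    have hE0 : ∀ x : ℝ, (x - x₀) ^ 2 + B ^ 2 ≠ 0 := fun x => by positivity
    have hea : IsAlgebraic ℚ (δ * q / m) := by
      rw [div_eq_mul_inv]; exact (hδ.mul hq).mul hma.inv
    have hterm : ∀ x : ℝ, bakerTerm p q γ δ x =
        γ * (x - x₀) / ((x - x₀) ^ 2 + B ^ 2) + δ * q / m / ((x - x₀) ^ 2 + B ^ 2) := by
      intro x
      rw [bakerTerm_eq_of_ne p q γ δ x hq0, hB, hx₀, hm]
    -- the two primitive pieces
    have hE : IsSemialgebraicFunOn ℚ (line (Icc u v)) (fun x => (x 0 - x₀) ^ 2 + B ^ 2) :=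
      ((hx.fun_sub (hc hx₀a)).fun_pow 2).fun_add (hc (by simpa [sq] using hBa.mul hBa))
    have hf₁ : IsSemialgebraicFunOn ℚ (line (Icc u v))
        (fun x => γ * (x 0 - x₀) / ((x 0 - x₀) ^ 2 + B ^ 2)) :=
      ((hc hγ).fun_mul (hx.fun_sub (hc hx₀a))).div hE fun x _ => hE0 (x 0)
    have hf₂ : IsSemialgebraicFunOn ℚ (line (Icc u v))
        (fun x => δ * q / m / ((x 0 - x₀) ^ 2 + B ^ 2)) :=
      (hc hea).div hE fun x _ => hE0 (x 0)
    have hi₁ : IntegrableOn (fun x => γ * (x - x₀) / ((x - x₀) ^ 2 + B ^ 2)) (Icc u v) :=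
      (ContinuousOn.div (by fun_prop) (by fun_prop) fun x _ => hE0 x).integrableOn_compact
        isCompact_Icc
    have hi₂ : IntegrableOn (fun x => δ * q / m / ((x - x₀) ^ 2 + B ^ 2)) (Icc u v) :=
      (ContinuousOn.div (by fun_prop) (by fun_prop) fun x _ => hE0 x).integrableOn_compact
        isCompact_Icc
    have h₁ := isCellSum_lineRep_lin_quad hu hv huv hγ hx₀a hBa hB0 (hS := hS) (hf := hf₁)
      (hi := hi₁)
    have h₂ := isCellSum_lineRep_inv_quad hu hv huv hea hx₀a hBa hB0 (hS := hS) (hf := hf₂)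
      (hi := hi₂)
    refine (h₁.add h₂).of_sub_mem ?_
    have h := of_sub_sub_mem_relations_of_add
      (r := lineRep (Icc u v) (bakerTerm p q γ δ) hS hf hi)
      (r₁ := lineRep (Icc u v) _ hS hf₁ hi₁) (r₂ := lineRep (Icc u v) _ hS hf₂ hi₂)
      (by simp only [lineRep_domain]) (by simp only [lineRep_domain])
      fun x _ => by simpa only [lineRep_integrand] using hterm (x 0)
    simpa [sub_sub] using h

end term

/-! ## A rational piece is a cell sum -/

/-- **A compact rational piece is a cell sum.**  For `P, Q ∈ ℚ[X]`, `Q ≠ 0` on `(a, b) ∋ 0`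
(`a, b` algebraic) and `[u, v] ⊂ (a, b)` with algebraic end-points, `[[u, v], P/Q dx]` is a
cell sum. -/
theorem isCellSum_lineRep_ratFunc (P Q : ℚ[X]) {a b u v : ℝ} (ha : a < 0) (hb : 0 < b)
    (haa : IsAlgebraic ℚ a) (hba : IsAlgebraic ℚ b) (hau : a < u) (hvb : v < b) (huv : u ≤ v)
    (hu : IsAlgebraic ℚ u) (hv : IsAlgebraic ℚ v) (hQ : ∀ x ∈ Ioo a b, Polynomial.aeval x Q ≠ 0)
    {hS : IsSemialgebraic ℚ (line (Icc u v))}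
    {hf : IsSemialgebraicFunOn ℚ (line (Icc u v))
      (fun x => Polynomial.aeval (x 0) P / Polynomial.aeval (x 0) Q)}
    {hi : IntegrableOn (fun x => Polynomial.aeval x P / Polynomial.aeval x Q) (Icc u v)} :
    IsCellSum (of (lineRep (Icc u v)
      (fun x => Polynomial.aeval x P / Polynomial.aeval x Q) hS hf hi)) := by
  classical
  obtain ⟨ρ, A, p, q, γ, δ, hρ, han, hp, hq, hγ, hδ, hpos, heq⟩ :=
    KZ.BakerSectorComplex.exists_bakerNormalForm P Q ha hb (isSemialgebraic_line_Ioo haa hba) hQ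
  have hsub : Icc u v ⊆ Ioo a b := fun x hx => ⟨hau.trans_le hx.1, hx.2.trans_lt hvb⟩
  have hpos' : ∀ k, ∀ x ∈ Icc u v, 0 < 1 - p k * x ∨ q k * x ≠ 0 :=
    fun k x hx => hpos k x (hsub hx)
  -- the Newton–Leibniz integrand
  set g : ℝ → ℝ := fun x => Polynomial.aeval x P / Polynomial.aeval x Q -
    ∑ k, bakerTerm (p k) (q k) (γ k) (δ k) x with hg
  have hfk : ∀ k, IsSemialgebraicFunOn ℚ (line (Icc u v))
      (fun x => bakerTerm (p k) (q k) (γ k) (δ k) (x 0)) :=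
    fun k => isSemialgebraicFunOn_bakerTerm (hp k) (hq k) (hγ k) (hδ k) hS (hpos' k)
  have hik : ∀ k, IntegrableOn (bakerTerm (p k) (q k) (γ k) (δ k)) (Icc u v) :=
    fun k => (continuousOn_bakerTerm (hpos' k)).integrableOn_compact isCompact_Icc
  have hgs : IsSemialgebraicFunOn ℚ (line (Icc u v)) (fun x => g (x 0)) :=
    hf.fun_sub (IsSemialgebraicFunOn.fun_finsetSum univ hS fun k _ => hfk k)
  have hQ' : ∀ x ∈ Icc u v, Polynomial.aeval x Q ≠ 0 := fun x hx => hQ x (hsub hx)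
  have hgc : ContinuousOn g (Icc u v) := by
    refine ContinuousOn.sub (ContinuousOn.div (Polynomial.continuous_aeval P).continuousOn
      (Polynomial.continuous_aeval Q).continuousOn hQ') ?_
    exact continuousOn_finsetSum _ fun k _ => continuousOn_bakerTerm (hpos' k)
  have hgi : IntegrableOn g (Icc u v) := hgc.integrableOn_compact isCompact_Icc
  -- Newton–Leibniz for `g = ρ'`
  have hρ' : IsSemialgebraicFunOn ℚ (line (Icc u v)) (fun x => ρ (x 0)) :=
    hρ.mono (line_mono hsub) hS
  have hρc : ContinuousOn ρ (Icc u v) :=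
    fun x hx => (han x (hsub hx)).continuousAt.continuousWithinAt
  have hder : ∀ t ∈ Ioo u v, HasDerivAt ρ (g t) t := by
    intro t ht
    have ht' : t ∈ Ioo a b := hsub (Ioo_subset_Icc_self ht)
    have h := (han t ht').differentiableAt.hasDerivAt
    have h' := heq t ht'
    simp only [← bakerTerm_apply] at h'
    have e : deriv ρ t = g t := by rw [hg]; linarith
    rwa [e] at h
  have hα : IsAlgebraic ℚ (ρ v - ρ u) :=
    (hρ.isAlgebraic_apply_one (S := Ioo a b) (hsub (right_mem_Icc.mpr huv)) hv).sub
      (hρ.isAlgebraic_apply_one (S := Ioo a b) (hsub (left_mem_Icc.mpr huv)) hu)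
  have hNL := lineRep_newtonLeibniz hu hv huv ρ hρ' hρc hder (hS := hS) (hf := hgs) (hi := hgi)
    (hα := hα)
  have hcellg : IsCellSum (of (lineRep (Icc u v) g hS hgs hgi)) :=
    (isCellSum_constCell _ hα).of_sub_mem hNL
  -- the terms
  have hcellk : ∀ k, IsCellSum (of (lineRep (Icc u v) (bakerTerm (p k) (q k) (γ k) (δ k)) hS
      (hfk k) (hik k))) :=
    fun k => isCellSum_lineRep_bakerTerm hu hv huv (hp k) (hq k) (hγ k) (hδ k) (hpos' k)
  -- additivity of the integrand
  set R : Option (Fin A) → IntegralRep 1 := fun o => o.elim (lineRep (Icc u v) g hS hgs hgi)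
    fun k => lineRep (Icc u v) (bakerTerm (p k) (q k) (γ k) (δ k)) hS (hfk k) (hik k) with hR
  have hadd := of_sub_sum_integrand_mem_relations univ R
    (lineRep (Icc u v) (fun x => Polynomial.aeval x P / Polynomial.aeval x Q) hS hf hi)
    (fun o _ => by cases o <;> simp only [hR, Option.elim, lineRep_domain]) fun x _ => by
      simp only [lineRep_integrand, Fintype.sum_option, hR, Option.elim, hg]
      ring
  refine (hcellg.add (IsCellSum.sum univ _ fun k _ => hcellk k)).of_sub_mem ?_
  simpa [Fintype.sum_option, hR, add_comm, add_left_comm, add_assoc, sub_eq_add_neg] using hadd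

end SoloBlind

end Summit.KontsevichZagierPeriods.KontsevichZagierPeriods.Theorems
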